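import Literature.Barriers.MatrixMultiplication.QuasirandomBarrierProofs
import Literature.RepresentationTheory.FiniteGroups.ProductGroupCharacters
import Literature.RepresentationTheory.FiniteGroups.PiGroupCharacters
import HarnessLib

/-!
# Barrier (sequel to `QuasirandomBarrier.lean`): direct products escape the representation-theoretic
# barrier — `n(G₁ × ⋯ × G_k) = minᵢ n(Gᵢ)` (BCGPU 2023, §1.1)

Topic `Literature/Barriers/MatrixMultiplication` (D-0021 catalogue for the summit
`MatrixMultiplication`, `ω(ℂ) = 2`); attached to the catalogue entry `QuasirandomBarrier`, whose
`evasions_known:` line quotes the sentence formalized here.  Everything is **proved**; no definition,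
no named fact.

Source.  J. Blasiak, H. Cohn, J. A. Grochow, K. Pratt, C. Umans, *Matrix multiplication via matrix
groups*, ITCS 2023 = arXiv:2204.03826 [BlasiakCohnGrochowPrattUmans2023], §1.1, p. 4 (held copy
`paper:arxiv-2204.03826`, chunk p0004, read this session), verbatim:

> "Our first barrier result rules out obtaining exponent 2 from finite groups of Lie type, but
> still leaves open the possibility that such groups could serve as building blocks in efficient
> algorithms for matrix multiplication. For example, the direct product of such groups escapes the
> barrier entirely, since the second-smallest dimension of an irreducible representation of a direct
> product equals the second-smallest dimension among the irreducible representations of the factors."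

and §5, p. 12: "Theorem 3.2 shows that `SL(n,q)^m` cannot give `ω = 2` for fixed `m` and growing
`q`. … Is there a common generalization … with `m` and `q` both growing?"

## What is proved

With `n(G) = secondCharDegree G` (Def. 3.1, `QuasirandomBarrier.lean`) and the tree's description of
the irreducible characters of a finite direct product as external products (Serre §3.2 Thm. 10:
`exists_eq_boxProd_of_mem_irrChars`, `IsIrrChar.boxProd` for `K × L`; `exists_eq_piBox_of_mem_irrChars`,
`IsIrrChar.piBox` for `Π i, G i`):

* `secondCharDegree_mem_charDegrees` — for a finite non-abelian group, `n(G)` is attained: it is a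
  character degree `> 1` (Def. 3.1 is a minimum over a non-empty set, by Serre's Thm. 9);
* **`secondCharDegree_prod`** — `n(K × L) = min(n(K), n(L))` for finite non-abelian `K`, `L`;
* **`secondCharDegree_pi`** — `n(Π i, G i) = minᵢ n(G i)` for a finite non-empty family of finite
  non-abelian groups (the printed sentence); **`secondCharDegree_pow`** — `n(H^m) = n(H)` (`m ≥ 1`);
* the escape, effective: **`tpp_card_le_pow`** — Thm. 3.2 in `G = H^m` reads
  `|S||T||U| ≤ |G|^{3/2}/√n(H) + |G|`: the saving `√n(H)` does not grow with `m`, so for fixed `H`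
  (e.g. `H = SL(n, q)`, `q` fixed) Thm. 3.2 puts no obstruction of the form `|G|^{3/2 − δ}` on the
  powers `H^m`, `m → ∞` — "escapes the barrier entirely".

## Rendering and wording risks

* "Among the irreducible representations of the factors" is read, as the context ("the direct product
  of such groups", i.e. of groups with large `n`) requires, for NON-ABELIAN factors: for an abelian
  factor `A`, `n(A)` is undefined in print (junk `0` in the tree) while `n(K × A) = n(K)`
  (`secondCharDegree_prod_of_comm`, also proved).
* Nothing here says that powers `H^m` DO yield good constructions; the STPP/TPP capacity of `SL(n,q)^m`
  with `m, q → ∞` is the authors' open question (§5), see `QuasirandomBarrier` evasions_known.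

WHAT THIS IS NOT: no statement about `ω`; no construction; not a barrier for direct powers (for
`SL(2,p)^m`, `p` fixed, see Sawin 2018 in the catalogue).
-/

noncomputable section

open scoped BigOperators

namespace Literature.Barriers.MatrixMultiplication

open Literature.RepresentationTheory.FiniteGroups Literature.Combinatorics.Additive

/-! ## §1 `n(G)` is attained -/

/-- For a finite non-abelian group, `n(G)` is a character degree `> 1` (Def. 3.1: "let
`n(G) := min_{π ∈ Irr(G) : dim π > 1} dim π`" — the minimum over a set that is non-empty by Serre's
Thm. 9, the tree's `Serre1977_thm9_holds`). [cite: BlasiakCohnGrochowPrattUmans2023, Def. 3.1] -/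
theorem secondCharDegree_mem_charDegrees {G : Type} [Group G] [Finite G]
    (hG : ∃ a b : G, a * b ≠ b * a) :
    secondCharDegree G ∈ charDegrees G ∧ 1 < secondCharDegree G := by
  have hne' : {d : ℕ | d ∈ charDegrees G ∧ 1 < d}.Nonempty := by
    obtain ⟨d, hd, h1⟩ := Serre1977_thm9_holds.exists_one_lt_mem_charDegrees G hG
    exact ⟨d, hd, h1⟩
  exact Nat.sInf_mem hne'

/-- If `G` has a character degree `> 1` then `n(G)` is a character degree `> 1` (no commutativity
hypothesis needed). [cite: BlasiakCohnGrochowPrattUmans2023, Def. 3.1] -/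
theorem secondCharDegree_mem_charDegrees_of_mem {G : Type} [Group G] {d : ℕ}
    (hd : d ∈ charDegrees G) (h1 : 1 < d) :
    secondCharDegree G ∈ charDegrees G ∧ 1 < secondCharDegree G :=
  Nat.sInf_mem (⟨d, hd, h1⟩ : {d : ℕ | d ∈ charDegrees G ∧ 1 < d}.Nonempty)

/-- An irreducible character of degree (the natural number) `d` witnesses `d ∈ charDegrees`.
[folklore] -/
private theorem mem_charDegrees_of_isIrrChar {G : Type} [Group G] {χ : G → ℂ} (hχ : IsIrrChar G χ)
    {d : ℕ} (hd : χ 1 = d) : d ∈ charDegrees G := by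
  obtain ⟨d', hd', hχd'⟩ := hχ.exists_apply_one
  have : d = d' := by exact_mod_cast hd.symm.trans hχd'
  rwa [this]

/-! ## §2 Binary products `K × L` -/

section Prod

variable {K L : Type} [Group K] [Group L] [Fintype K] [Fintype L]

/-- `n(K × L) ≤ n(K)` for `K` non-abelian: `ψ ⊠ 1_L` is irreducible of degree `n(K) > 1`.
[cite: BlasiakCohnGrochowPrattUmans2023, §1.1 (p. 4)] -/
theorem secondCharDegree_prod_le_left (hK : ∃ a b : K, a * b ≠ b * a) :
    secondCharDegree (K × L) ≤ secondCharDegree K := by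
  obtain ⟨hmem, h1⟩ := secondCharDegree_mem_charDegrees hK
  obtain ⟨ψ, hψ, hψ1⟩ := exists_isIrrChar_of_mem_charDegrees hmem
  obtain ⟨φ, hφ, hφ1⟩ := exists_isIrrChar_of_mem_charDegrees (one_mem_charDegrees (G := L))
  have hχ : IsIrrChar (K × L) (fun p : K × L => ψ p.1 * φ p.2) := IsIrrChar.boxProd hψ hφ
  have hχ1 : (fun p : K × L => ψ p.1 * φ p.2) 1 = (secondCharDegree K : ℕ) := by
    rw [boxProd_apply_one, hψ1, hφ1, Nat.cast_one, mul_one]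
  exact (secondCharDegree_le (mem_charDegrees_of_isIrrChar hχ hχ1) h1).2

/-- `n(K × L) ≤ n(L)` for `L` non-abelian: `1_K ⊠ φ` is irreducible of degree `n(L) > 1`.
[cite: BlasiakCohnGrochowPrattUmans2023, §1.1 (p. 4)] -/
theorem secondCharDegree_prod_le_right (hL : ∃ a b : L, a * b ≠ b * a) :
    secondCharDegree (K × L) ≤ secondCharDegree L := by
  obtain ⟨hmem, h1⟩ := secondCharDegree_mem_charDegrees hL
  obtain ⟨φ, hφ, hφ1⟩ := exists_isIrrChar_of_mem_charDegrees hmem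
  obtain ⟨ψ, hψ, hψ1⟩ := exists_isIrrChar_of_mem_charDegrees (one_mem_charDegrees (G := K))
  have hχ : IsIrrChar (K × L) (fun p : K × L => ψ p.1 * φ p.2) := IsIrrChar.boxProd hψ hφ
  have hχ1 : (fun p : K × L => ψ p.1 * φ p.2) 1 = (secondCharDegree L : ℕ) := by
    rw [boxProd_apply_one, hψ1, hφ1, Nat.cast_one, one_mul]
  exact (secondCharDegree_le (mem_charDegrees_of_isIrrChar hχ hχ1) h1).2

/-- The lower bound: every character degree `> 1` of `K × L` is `≥ n(K)` or `≥ n(L)` (it is a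
product `ψ(1)φ(1)` of degrees of the factors, one of which exceeds `1`), hence
`≥ min(n(K), n(L))` (for an abelian factor the junk value `n = 0` makes this vacuous). [cite: BlasiakCohnGrochowPrattUmans2023, §1.1 (p. 4)] -/
theorem min_secondCharDegree_le_of_mem_charDegrees_prod {d : ℕ} (hd : d ∈ charDegrees (K × L))
    (h1 : 1 < d) :
    min (secondCharDegree K) (secondCharDegree L) ≤ d := by
  obtain ⟨χ, hχ, hχd⟩ := exists_isIrrChar_of_mem_charDegrees hd
  obtain ⟨ψ, hψ, φ, hφ, rfl⟩ := exists_eq_boxProd_of_mem_irrChars hχ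
  obtain ⟨a, ha, hψa⟩ := IsIrrChar.exists_apply_one hψ
  obtain ⟨b, hb, hφb⟩ := IsIrrChar.exists_apply_one hφ
  have hdab : (d : ℂ) = a * b := by rw [← hχd, boxProd_apply_one, hψa, hφb]
  have hd' : d = a * b := by exact_mod_cast hdab
  have ha0 := pos_of_mem_charDegrees ha
  have hb0 := pos_of_mem_charDegrees hb
  by_cases ha1 : 1 < a
  · have := (secondCharDegree_le ha ha1).2
    calc min (secondCharDegree K) (secondCharDegree L) ≤ secondCharDegree K := min_le_left _ _
      _ ≤ a := this
      _ ≤ d := by rw [hd']; exact Nat.le_mul_of_pos_right a hb0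
  · have ha1' : a = 1 := by omega
    have hb1 : 1 < b := by rw [hd', ha1', one_mul] at h1; exact h1
    have := (secondCharDegree_le hb hb1).2
    calc min (secondCharDegree K) (secondCharDegree L) ≤ secondCharDegree L := min_le_right _ _
      _ ≤ b := this
      _ ≤ d := by rw [hd', ha1', one_mul]

/-- **`n(K × L) = min(n(K), n(L))`** for finite non-abelian groups `K`, `L` ("the second-smallest
dimension of an irreducible representation of a direct product equals the second-smallest dimension
among the irreducible representations of the factors"). [cite: BlasiakCohnGrochowPrattUmans2023, §1.1 (p. 4)] -/
theorem secondCharDegree_prod (hK : ∃ a b : K, a * b ≠ b * a) (hL : ∃ a b : L, a * b ≠ b * a) :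
    secondCharDegree (K × L) = min (secondCharDegree K) (secondCharDegree L) := by
  refine le_antisymm (le_min (secondCharDegree_prod_le_left hK) (secondCharDegree_prod_le_right hL)) ?_
  -- `n(K × L)` is itself a degree `> 1` of `K × L`
  obtain ⟨hmemK, h1K⟩ := secondCharDegree_mem_charDegrees hK
  obtain ⟨ψ, hψ, hψ1⟩ := exists_isIrrChar_of_mem_charDegrees hmemK
  obtain ⟨φ, hφ, hφ1⟩ := exists_isIrrChar_of_mem_charDegrees (one_mem_charDegrees (G := L))
  have hχ : IsIrrChar (K × L) (fun p : K × L => ψ p.1 * φ p.2) := IsIrrChar.boxProd hψ hφ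
  have hχ1 : (fun p : K × L => ψ p.1 * φ p.2) 1 = (secondCharDegree K : ℕ) := by
    rw [boxProd_apply_one, hψ1, hφ1, Nat.cast_one, mul_one]
  obtain ⟨hmem, h1⟩ := secondCharDegree_mem_charDegrees_of_mem (mem_charDegrees_of_isIrrChar hχ hχ1) h1K
  exact min_secondCharDegree_le_of_mem_charDegrees_prod hmem h1

/-- With an abelian second factor nothing changes: `n(K × A) = n(K)` for `K` non-abelian and `A`
finite abelian (every degree of `A` is `1`, Serre Thm. 9). [cite: BlasiakCohnGrochowPrattUmans2023, §1.1 (p. 4)] -/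
theorem secondCharDegree_prod_of_comm (hK : ∃ a b : K, a * b ≠ b * a) (hL : ∀ a b : L, a * b = b * a) :
    secondCharDegree (K × L) = secondCharDegree K := by
  refine le_antisymm (secondCharDegree_prod_le_left hK) ?_
  obtain ⟨hmemK, h1K⟩ := secondCharDegree_mem_charDegrees hK
  obtain ⟨ψ, hψ, hψ1⟩ := exists_isIrrChar_of_mem_charDegrees hmemK
  obtain ⟨φ, hφ, hφ1⟩ := exists_isIrrChar_of_mem_charDegrees (one_mem_charDegrees (G := L))
  have hχ : IsIrrChar (K × L) (fun p : K × L => ψ p.1 * φ p.2) := IsIrrChar.boxProd hψ hφ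
  have hχ1 : (fun p : K × L => ψ p.1 * φ p.2) 1 = (secondCharDegree K : ℕ) := by
    rw [boxProd_apply_one, hψ1, hφ1, Nat.cast_one, mul_one]
  obtain ⟨hmem, h1⟩ := secondCharDegree_mem_charDegrees_of_mem (mem_charDegrees_of_isIrrChar hχ hχ1) h1K
  -- the degree `n(K × L) > 1` is `a · b` with `b = 1`
  obtain ⟨χ, hχ', hχd⟩ := exists_isIrrChar_of_mem_charDegrees hmem
  obtain ⟨ψ', hψ', φ', hφ', rfl⟩ := exists_eq_boxProd_of_mem_irrChars hχ'
  obtain ⟨a, ha, hψa⟩ := IsIrrChar.exists_apply_one hψ'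
  obtain ⟨b, hb, hφb⟩ := IsIrrChar.exists_apply_one hφ'
  have hb1 : b = 1 := (Serre1977_thm9_holds L).mp hL b hb
  have hdab : ((secondCharDegree (K × L) : ℕ) : ℂ) = a * b := by rw [← hχd, boxProd_apply_one, hψa, hφb]
  have hd' : secondCharDegree (K × L) = a * b := by exact_mod_cast hdab
  rw [hb1, mul_one] at hd'
  rw [hd'] at h1 ⊢
  exact (secondCharDegree_le ha h1).2

end Prod

/-! ## §3 Finite products `Π i, G i` and powers `H^m` -/

section Pi

variable {ι : Type} [Fintype ι] [DecidableEq ι] {G : ι → Type} [∀ i, Group (G i)]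
  [∀ i, Fintype (G i)]

/-- `n(Π i, G i) ≤ n(G j)` for each non-abelian factor `G j` (the external product of an irreducible
character of `G j` of degree `n(G j)` with trivial characters elsewhere).
[cite: BlasiakCohnGrochowPrattUmans2023, §1.1 (p. 4)] -/
theorem secondCharDegree_pi_le (j : ι) (hj : ∃ a b : G j, a * b ≠ b * a) :
    secondCharDegree (∀ i, G i) ≤ secondCharDegree (G j) := by
  classical
  obtain ⟨hmem, h1⟩ := secondCharDegree_mem_charDegrees hj
  obtain ⟨ψj, hψj, hψj1⟩ := exists_isIrrChar_of_mem_charDegrees hmem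
  have htriv : ∀ i, ∃ φ : G i → ℂ, φ ∈ irrChars (G i) ∧ φ 1 = ((1 : ℕ) : ℂ) := fun i =>
    exists_isIrrChar_of_mem_charDegrees (one_mem_charDegrees (G := G i))
  choose φ hφ hφ1 using htriv
  -- the tuple: `ψj` at `j`, trivial degrees elsewhere
  let ψ : ∀ i, G i → ℂ := fun i => if h : i = j then (by subst h; exact ψj) else φ i
  have hψ : ∀ i, IsIrrChar (G i) (ψ i) := by
    intro i
    by_cases h : i = j
    · subst h; simp only [ψ, dif_pos]; exact hψj
    · simp only [ψ, dif_neg h]; exact hφ i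
  have hψ1 : ∀ i, ψ i 1 = if i = j then ((secondCharDegree (G j) : ℕ) : ℂ) else 1 := by
    intro i
    by_cases h : i = j
    · subst h; simp only [ψ, dif_pos, if_pos]; exact hψj1
    · simp only [ψ, dif_neg h, if_neg h]; rw [hφ1 i, Nat.cast_one]
  have hχ : IsIrrChar (∀ i, G i) (fun y => ∏ i, ψ i (y i)) := IsIrrChar.piBox hψ
  have hχ1 : (fun y : ∀ i, G i => ∏ i, ψ i (y i)) 1 = ((secondCharDegree (G j) : ℕ) : ℂ) := by
    rw [piBox_apply_one]
    simp_rw [hψ1]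
    rw [Finset.prod_ite_eq' Finset.univ j, if_pos (Finset.mem_univ j)]
  exact (secondCharDegree_le (mem_charDegrees_of_isIrrChar hχ hχ1) h1).2

/-- The lower bound: a character degree `> 1` of `Π i, G i` is a product `∏ᵢ dᵢ` of degrees of the
factors with some `d_j > 1`, hence `≥ n(G j) ≥ minᵢ n(G i)`.
[cite: BlasiakCohnGrochowPrattUmans2023, §1.1 (p. 4)] -/
theorem inf_secondCharDegree_le_of_mem_charDegrees_pi [Nonempty ι] {d : ℕ}
    (hd : d ∈ charDegrees (∀ i, G i)) (h1 : 1 < d) :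
    Finset.univ.inf' Finset.univ_nonempty (fun i => secondCharDegree (G i)) ≤ d := by
  classical
  obtain ⟨χ, hχ, hχd⟩ := exists_isIrrChar_of_mem_charDegrees hd
  obtain ⟨ψ, hψ, rfl⟩ := exists_eq_piBox_of_mem_irrChars hχ
  have hdeg : ∀ i, ∃ a : ℕ, a ∈ charDegrees (G i) ∧ ψ i 1 = a := fun i =>
    let ⟨a, ha, h⟩ := IsIrrChar.exists_apply_one (hψ i); ⟨a, ha, h⟩
  choose a ha hψa using hdeg
  have hd' : (d : ℂ) = ∏ i, (a i : ℂ) := by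
    rw [← hχd, piBox_apply_one]
    exact Finset.prod_congr rfl fun i _ => hψa i
  have hd'' : d = ∏ i, a i := by exact_mod_cast hd'
  have ha0 : ∀ i, 0 < a i := fun i => pos_of_mem_charDegrees (ha i)
  -- some factor exceeds `1`
  have hex : ∃ j, 1 < a j := by
    by_contra hall
    push Not at hall
    have : ∏ i, a i = 1 := Finset.prod_eq_one fun i _ => le_antisymm (hall i) (ha0 i)
    omega
  obtain ⟨j, hj⟩ := hex
  calc Finset.univ.inf' Finset.univ_nonempty (fun i => secondCharDegree (G i))
      ≤ secondCharDegree (G j) := Finset.inf'_le _ (Finset.mem_univ j)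
    _ ≤ a j := (secondCharDegree_le (ha j) hj).2
    _ ≤ ∏ i, a i := by
        rw [← Finset.mul_prod_erase Finset.univ a (Finset.mem_univ j)]
        exact Nat.le_mul_of_pos_right _ (Finset.prod_pos fun i _ => ha0 i)
    _ = d := hd''.symm

/-- **`n(Π i, G i) = minᵢ n(G i)`** for a non-empty finite family of finite non-abelian groups ("the
second-smallest dimension of an irreducible representation of a direct product equals the
second-smallest dimension among the irreducible representations of the factors").
[cite: BlasiakCohnGrochowPrattUmans2023, §1.1 (p. 4)] -/
theorem secondCharDegree_pi [Nonempty ι] (hG : ∀ i, ∃ a b : G i, a * b ≠ b * a) :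
    secondCharDegree (∀ i, G i) =
      Finset.univ.inf' Finset.univ_nonempty (fun i => secondCharDegree (G i)) := by
  classical
  refine le_antisymm ((Finset.le_inf'_iff _ _).mpr fun j _ => secondCharDegree_pi_le j (hG j)) ?_
  -- `n(Π G)` is a degree `> 1`: below `n(G j₀)` there is the degree of `ψ_{j₀} ⊠ 1`
  obtain ⟨j₀⟩ := ‹Nonempty ι›
  obtain ⟨hmemj, h1j⟩ := secondCharDegree_mem_charDegrees (hG j₀)
  -- produce a degree `> 1` of the product to know `n(Π G)` is attained
  obtain ⟨ψj, hψj, hψj1⟩ := exists_isIrrChar_of_mem_charDegrees hmemj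
  have htriv : ∀ i, ∃ φ : G i → ℂ, φ ∈ irrChars (G i) ∧ φ 1 = ((1 : ℕ) : ℂ) := fun i =>
    exists_isIrrChar_of_mem_charDegrees (one_mem_charDegrees (G := G i))
  choose φ hφ hφ1 using htriv
  let ψ : ∀ i, G i → ℂ := fun i => if h : i = j₀ then (by subst h; exact ψj) else φ i
  have hψ : ∀ i, IsIrrChar (G i) (ψ i) := by
    intro i
    by_cases h : i = j₀
    · subst h; simp only [ψ, dif_pos]; exact hψj
    · simp only [ψ, dif_neg h]; exact hφ i
  have hψ1 : ∀ i, ψ i 1 = if i = j₀ then ((secondCharDegree (G j₀) : ℕ) : ℂ) else 1 := by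
    intro i
    by_cases h : i = j₀
    · subst h; simp only [ψ, dif_pos, if_pos]; exact hψj1
    · simp only [ψ, dif_neg h, if_neg h]; rw [hφ1 i, Nat.cast_one]
  have hχ : IsIrrChar (∀ i, G i) (fun y => ∏ i, ψ i (y i)) := IsIrrChar.piBox hψ
  have hχ1 : (fun y : ∀ i, G i => ∏ i, ψ i (y i)) 1 = ((secondCharDegree (G j₀) : ℕ) : ℂ) := by
    rw [piBox_apply_one]
    simp_rw [hψ1]
    rw [Finset.prod_ite_eq' Finset.univ j₀, if_pos (Finset.mem_univ j₀)]
  obtain ⟨hmem, h1⟩ :=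
    secondCharDegree_mem_charDegrees_of_mem (mem_charDegrees_of_isIrrChar hχ hχ1) h1j
  exact inf_secondCharDegree_le_of_mem_charDegrees_pi hmem h1

end Pi

section Pow

variable {H : Type} [Group H] [Fintype H]

omit [Fintype H] in
/-- A power `H^m` (`m ≥ 1`) of a non-abelian group is non-abelian (constant tuples). [folklore] -/
private theorem exists_not_commute_pow (hH : ∃ a b : H, a * b ≠ b * a) {m : ℕ} (hm : 1 ≤ m) :
    ∃ a b : Fin m → H, a * b ≠ b * a := by
  obtain ⟨a, b, hab⟩ := hH
  refine ⟨fun _ => a, fun _ => b, fun h => hab ?_⟩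
  have := congrFun h ⟨0, hm⟩
  simpa using this

/-- **`n(H^m) = n(H)`** for a finite non-abelian group `H` and `m ≥ 1` (the case of equal factors:
`SL(n,q)^m`, `q` fixed, §5). [cite: BlasiakCohnGrochowPrattUmans2023, §1.1 (p. 4) and §5 (p. 12)] -/
theorem secondCharDegree_pow (hH : ∃ a b : H, a * b ≠ b * a) {m : ℕ} (hm : 1 ≤ m) :
    secondCharDegree (Fin m → H) = secondCharDegree H := by
  haveI : Nonempty (Fin m) := ⟨⟨0, hm⟩⟩
  rw [secondCharDegree_pi (G := fun _ : Fin m => H) (fun _ => hH), Finset.inf'_const]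

/-- **The escape, effective**: Thm. 3.2 in a power `G = H^m` of a finite non-abelian group reads
`|S||T||U| ≤ |G|^{3/2}/√n(H) + |G|` for every TPP triple — the saving `√n(H)` is independent of `m`
(`n(H^m) = n(H)`), so Thm. 3.2 yields no bound `|G|^{3/2 − δ}`, `δ > 0`, uniformly on the powers of
a fixed `H` ("the direct product of such groups escapes the barrier entirely").
[cite: BlasiakCohnGrochowPrattUmans2023, §1.1 (p. 4) and Thm. 3.2] -/
theorem tpp_card_le_pow (hH : ∃ a b : H, a * b ≠ b * a) {m : ℕ} (hm : 1 ≤ m)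
    (S T U : Finset (Fin m → H)) (hTPP : TripleProductProperty S T U) :
    ((S.card * T.card * U.card : ℕ) : ℝ) ≤
      (Fintype.card (Fin m → H) : ℝ) ^ (3 / 2 : ℝ) / Real.sqrt (secondCharDegree H) +
        Fintype.card (Fin m → H) := by
  have h := BCGPU2023_thm32_holds (Fin m → H) (exists_not_commute_pow hH hm) S T U hTPP
  rwa [secondCharDegree_pow hH hm] at h

end Pow

end Literature.Barriers.MatrixMultiplication

end
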